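import Literature.Analysis.OperatorTheory.YangMillsMatrixModelEnergyBilinear
import Literature.Analysis.PDE.HopfLemmas
import HarnessLib

/-!
# Comparison with a positive solution of `𝔥u = Eu` on `ℝ⁹` (generalised maximum principle)

Topic `Literature/Analysis/OperatorTheory`, companion of `YangMillsMatrixModelGroundStatePositivity.lean`
(strict positivity of the ground state of Lüscher's matrix-model Hamiltonian `𝔥 = −½Δ + V` on `ℝ⁹`,
`V = ¼Σ|x_i × x_j|²`) and the input of `YangMillsMatrixModelGroundStateLowerBound.lean` (the pointwise
lower bound `f_0(y) ≥ c·e^{−a(1+‖y‖)³}` of Carmona–Simon type).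

The zeroth-order coefficient `V − E` of `𝔥 − E` has NO SIGN (the potential vanishes on the valley of
parallel triples, `luscherPotential_parallel`), so the classical weak maximum principle does not apply to
`𝔥 − E` directly.  It does apply after the ground-state transform by a POSITIVE solution `u` of
`𝔥u = Eu` (Protter–Weinberger, *Maximum Principles*, Ch. 2 §5; López-Gómez 2012, Thm. 1.7): for
`w = ρ·u` one has `(𝔥 − E)w = −½uΔρ − ∇u·∇ρ`, an operator on `ρ` WITHOUT zeroth-order term, and at an
interior maximum of `ρ` the right-hand side is `≥ 0`.  Contents (all proved, no definitions, no named facts):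

* §1 `pderiv_pderiv_mul`, `laplacian_mul`, ★ `hApply_mul` — the Leibniz rule
  `𝔥(ρu) = ρ·𝔥u − ½uΔρ − Σ_p ∂_pρ ∂_pu` for `ρ, u ∈ C²(ℝ⁹)`;
* §2 `pderiv_eq_zero_of_isLocalMax`, `pderiv_pderiv_nonpos_of_isLocalMax`, `laplacian_nonpos_of_isLocalMax` —
  first- and second-order necessary conditions at a local maximum of a `C²` function (from the tree's
  `Literature.Analysis.PDE.fderiv_fderiv_nonneg_of_isLocalMin`);
* §3 ★ `le_of_strict_subsolution` — **comparison**: if `u > 0`, `𝔥u = Eu` on `ℝ⁹`, `w ∈ C²`,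
  `(𝔥 − E)w < 0` on an open `Ω` contained in a compact `K`, and `w ≤ u` on `K ∖ Ω`, then `w ≤ u` on `K`
  (maximise `ρ = w/u` over `K`; a maximum with `ρ > 1` is interior, where `∇ρ = 0`, `Δρ ≤ 0`, hence
  `(𝔥 − E)w = −½uΔρ ≥ 0`, contradicting strictness).

## References
* [LopezGomez2012] J. López-Gómez, *Linear Second Order Elliptic Operators*, World Scientific (2012), Ch. 1,
  Thm. 1.1 (minimum principle at a point), Thm. 1.7 (generalised minimum principle: division by a positive
  strict supersolution).
* [ProtterWeinberger1984] M. H. Protter, H. F. Weinberger, *Maximum Principles in Differential Equations*,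
  Springer (1984), Ch. 2 §5 (the generalised maximum principle `v = w/u`).
* [CarmonaSimon1981] R. Carmona, B. Simon, Comm. Math. Phys. 80 (1981) 59–98 (pointwise lower bounds on
  ground states — the statement served downstream; their proof is path-integral, ours is by comparison).
-/

noncomputable section

open Filter Set
open scoped BigOperators Topology

namespace Literature.Analysis.OperatorTheory.YMMatrixModel

variable {ρ u w : ZM → ℝ}

/-! ### 1. Leibniz rules for `Δ` and `𝔥` -/

/-- **Second-order Leibniz rule** in one coordinate: for `ρ, u ∈ C²(ℝ⁹)`,
`∂_p∂_p(ρu) = (∂_p∂_pρ)·u + 2·∂_pρ·∂_pu + ρ·∂_p∂_pu` (the computation behind the generalised maximum principle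
`v = w/u`). [cite: ProtterWeinberger1984, Ch. 2 §5] -/
theorem pderiv_pderiv_mul (hρ : ContDiff ℝ 2 ρ) (hu : ContDiff ℝ 2 u) (p : Fin 3 × Fin 3) (x : ZM) :
    pderiv p (pderiv p (ρ * u)) x =
      pderiv p (pderiv p ρ) x * u x + 2 * (pderiv p ρ x * pderiv p u x) +
        ρ x * pderiv p (pderiv p u) x := by
  have hρd : Differentiable ℝ ρ := differentiable_of_contDiff_two hρ
  have hud : Differentiable ℝ u := differentiable_of_contDiff_two hu
  have hρ1 : Differentiable ℝ (pderiv p ρ) := differentiable_pderiv_of_contDiff_two hρ p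
  have hu1 : Differentiable ℝ (pderiv p u) := differentiable_pderiv_of_contDiff_two hu p
  have h1 : pderiv p (ρ * u) = pderiv p ρ * u + ρ * pderiv p u := by
    funext y
    rw [pderiv_mul hρd hud p y]
    rfl
  rw [h1, pderiv_add (hρ1.mul hud) (hρd.mul hu1), pderiv_mul hρ1 hud, pderiv_mul hρd hu1]
  ring

/-- **Leibniz rule for the Laplacian**: `Δ(ρu) = (Δρ)u + 2 Σ_p ∂_pρ ∂_pu + ρ Δu` for `ρ, u ∈ C²(ℝ⁹)`.
[cite: ProtterWeinberger1984, Ch. 2 §5] -/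
theorem laplacian_mul (hρ : ContDiff ℝ 2 ρ) (hu : ContDiff ℝ 2 u) (x : ZM) :
    laplacian (ρ * u) x =
      laplacian ρ x * u x + 2 * ∑ p, pderiv p ρ x * pderiv p u x + ρ x * laplacian u x := by
  simp only [laplacian_def, pderiv_pderiv_mul hρ hu, Finset.sum_add_distrib, ← Finset.sum_mul,
    ← Finset.mul_sum]

/-- ★ **Leibniz rule for `𝔥`** (the ground-state transform): for `ρ, u ∈ C²(ℝ⁹)`,
`𝔥(ρu)(x) = ρ(x)·𝔥u(x) − ½u(x)Δρ(x) − Σ_p ∂_pρ(x) ∂_pu(x)`.  With `𝔥u = Eu` this reads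
`(𝔥 − E)(ρu) = −½uΔρ − ∇u·∇ρ`: an operator on `ρ` with no zeroth-order term.
[cite: LopezGomez2012, Thm. 1.7] -/
theorem hApply_mul (hρ : ContDiff ℝ 2 ρ) (hu : ContDiff ℝ 2 u) (x : ZM) :
    hApply (ρ * u) x =
      ρ x * hApply u x - (1 / 2 : ℝ) * u x * laplacian ρ x - ∑ p, pderiv p ρ x * pderiv p u x := by
  rw [hApply_def, hApply_def, laplacian_mul hρ hu]
  simp only [Pi.mul_apply]
  ring

/-! ### 2. Necessary conditions at a local maximum -/

/-- At a local maximum of `ρ` every partial derivative vanishes (Fermat). [cite: LopezGomez2012, Thm. 1.1] -/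
theorem pderiv_eq_zero_of_isLocalMax {x : ZM} (h : IsLocalMax ρ x) (p : Fin 3 × Fin 3) :
    pderiv p ρ x = 0 := by
  rw [pderiv, h.fderiv_eq_zero]
  rfl

/-- At a local maximum of a `C²` function every pure second partial is `≤ 0`
(`∂_p∂_pρ(x) = D²ρ(x)(e_p, e_p) ≤ 0`, the second-order condition on the line `t ↦ x + t e_p`).
[cite: LopezGomez2012, Thm. 1.1] -/
theorem pderiv_pderiv_nonpos_of_isLocalMax {x : ZM} (h : IsLocalMax ρ x) (hρ : ContDiff ℝ 2 ρ)
    (p : Fin 3 × Fin 3) : pderiv p (pderiv p ρ) x ≤ 0 := by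
  have hd : DifferentiableAt ℝ (fderiv ℝ ρ) x :=
    ((hρ.fderiv_right (m := 1) (by norm_num)).differentiable (by norm_num)) x
  have key : pderiv p (pderiv p ρ) x = fderiv ℝ (fderiv ℝ ρ) x (unitDir p) (unitDir p) := by
    have e : pderiv p ρ = fun y => fderiv ℝ ρ y (unitDir p) := rfl
    rw [pderiv, e, fderiv_clm_apply hd (differentiableAt_const _)]
    simp
  have hmin : IsLocalMin (fun y => -ρ y) x := h.neg
  have hρn : ContDiffAt ℝ 2 (fun y => -ρ y) x := hρ.neg.contDiffAt
  have h2 := Literature.Analysis.PDE.fderiv_fderiv_nonneg_of_isLocalMin hmin hρn (unitDir p)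
  have e1 : fderiv ℝ (fun y => -ρ y) = fun y => -fderiv ℝ ρ y := by
    funext y
    exact fderiv_neg
  have e2 : fderiv ℝ (fun y => -fderiv ℝ ρ y) x = -fderiv ℝ (fderiv ℝ ρ) x := fderiv_neg
  rw [e1, e2] at h2
  rw [key]
  simp only [neg_apply] at h2
  linarith

/-- At a local maximum of a `C²` function the Laplacian is `≤ 0`. [cite: LopezGomez2012, Thm. 1.1] -/
theorem laplacian_nonpos_of_isLocalMax {x : ZM} (h : IsLocalMax ρ x) (hρ : ContDiff ℝ 2 ρ) :
    laplacian ρ x ≤ 0 := by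
  rw [laplacian_def]
  exact Finset.sum_nonpos fun p _ => pderiv_pderiv_nonpos_of_isLocalMax h hρ p

/-! ### 3. The comparison principle -/

/-- ★ **Comparison with a positive solution (generalised maximum principle for `𝔥 − E`).**
Let `u ∈ C²(ℝ⁹)`, `u > 0`, `𝔥u = Eu` everywhere; let `w ∈ C²(ℝ⁹)` be a STRICT subsolution,
`𝔥w < Ew`, on an open set `Ω` contained in a compact set `K`, with `w ≤ u` on `K ∖ Ω`.  Then `w ≤ u`
on `K`.  Proof: `ρ = w/u ∈ C²` attains its maximum over `K` at some `x⋆`; if `ρ(x⋆) > 1` then `x⋆ ∈ Ω`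
is an interior local maximum, so `∇ρ(x⋆) = 0`, `Δρ(x⋆) ≤ 0`, and the Leibniz rule gives
`(𝔥 − E)w(x⋆) = −½u(x⋆)Δρ(x⋆) ≥ 0`, contradicting `𝔥w < Ew` on `Ω`.  (No sign condition on `V − E` is
needed: the positive solution `u` replaces it.) [cite: LopezGomez2012, Thm. 1.7] -/
theorem le_of_strict_subsolution {E : ℝ} {K Ω : Set ZM} (hK : IsCompact K) (hΩ : IsOpen Ω) (hΩK : Ω ⊆ K)
    (hu : ContDiff ℝ 2 u) (hw : ContDiff ℝ 2 w) (hpos : ∀ x, 0 < u x)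
    (hEq : ∀ x, hApply u x = E * u x) (hsub : ∀ x ∈ Ω, hApply w x < E * w x)
    (hbdry : ∀ x ∈ K, x ∉ Ω → w x ≤ u x) : ∀ x ∈ K, w x ≤ u x := by
  intro x₀ hx₀
  set ρ : ZM → ℝ := fun y => w y / u y with hρdef
  have hρ2 : ContDiff ℝ 2 ρ := hw.div hu fun y => (hpos y).ne'
  have hwρ : w = ρ * u := by
    funext y
    simp only [Pi.mul_apply, hρdef]
    rw [div_mul_cancel₀ _ (hpos y).ne']
  obtain ⟨xs, hxsK, hmax⟩ := hK.exists_isMaxOn ⟨x₀, hx₀⟩ hρ2.continuous.continuousOn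
  by_cases hle : ρ xs ≤ 1
  · have h1 : ρ x₀ ≤ 1 := (hmax hx₀).trans hle
    exact (div_le_one (hpos x₀)).1 h1
  · exfalso
    have hlt1 : 1 < ρ xs := not_le.1 hle
    have hwu : u xs < w xs := (one_lt_div (hpos xs)).1 hlt1
    have hxsΩ : xs ∈ Ω := by
      by_contra hn
      exact (not_le.2 hwu) (hbdry xs hxsK hn)
    have hloc : IsLocalMax ρ xs := hmax.isLocalMax (mem_of_superset (hΩ.mem_nhds hxsΩ) hΩK)
    have hgrad : ∀ p, pderiv p ρ xs = 0 := fun p => pderiv_eq_zero_of_isLocalMax hloc p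
    have hlap : laplacian ρ xs ≤ 0 := laplacian_nonpos_of_isLocalMax hloc hρ2
    have hlt := hsub xs hxsΩ
    rw [hwρ, hApply_mul hρ2 hu xs, hEq xs] at hlt
    simp only [hgrad, zero_mul, Finset.sum_const_zero, sub_zero, Pi.mul_apply] at hlt
    have hu0 : 0 < u xs := hpos xs
    have hprod : u xs * laplacian ρ xs ≤ 0 := mul_nonpos_of_nonneg_of_nonpos hu0.le hlap
    nlinarith

/-- The comparison principle with the boundary condition phrased on the whole compact set: if `w ≤ u`
fails only at points of `Ω`, it fails nowhere on `K`. [cite: LopezGomez2012, Thm. 1.7] -/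
theorem le_of_strict_subsolution' {E : ℝ} {K Ω : Set ZM} (hK : IsCompact K) (hΩ : IsOpen Ω) (hΩK : Ω ⊆ K)
    (hu : ContDiff ℝ 2 u) (hw : ContDiff ℝ 2 w) (hpos : ∀ x, 0 < u x)
    (hEq : ∀ x, hApply u x = E * u x) (hsub : ∀ x ∈ Ω, hApply w x < E * w x)
    (hbdry : ∀ x ∈ K, u x < w x → x ∈ Ω) {x : ZM} (hx : x ∈ K) : w x ≤ u x :=
  le_of_strict_subsolution hK hΩ hΩK hu hw hpos hEq hsub
    (fun y hy hyΩ => not_lt.1 fun h => hyΩ (hbdry y hy h)) x hx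

end Literature.Analysis.OperatorTheory.YMMatrixModel

end
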